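import Mathlib
import Literature.Analysis.FunctionSpaces.TorusFluidGlueProofs
import Literature.Analysis.FunctionSpaces.TorusFourierCalculus
import Literature.Analysis.FunctionSpaces.TorusVectorParseval
import HarnessLib

/-!
# Stub `stub_normsOfH1Limit` of the line `registered`
# (crux stmt-AnomalousDissipation-11414, `WindLine.WindyGalerkinSteadyZerothLaw`)

`H¹`-convergence `U N → u` of smooth vector fields on `T³`, in the form
`∫ ‖U N − u‖² + ‖∇(U N − u)‖₂² → 0`, gives convergence of the energy `∫ ‖U N‖² → ∫ ‖u‖²` and of the
squared gradient norm `‖∇ U N‖₂² → ‖∇ u‖₂²` (`Torus.gradNormSq`).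

Both summands are nonnegative, so each tends to `0`.  The energy part is the reverse triangle
inequality in `L²(T³; ℝ³)` (Mathlib's `Lp` with `p = 2`: `‖toLp v‖² = ∫ ‖v‖²`); the gradient part is
the energy part applied to each partial derivative `∂ᵢ U N → ∂ᵢ u` in `L²`, using
`gradNormSq v = ∑ᵢ ∫ ‖∂ᵢ v‖²` and linearity of `∂ᵢ` on smooth fields.
-/

noncomputable section

-- D-0017: single-problem summit ⇒ the duplicated namespace segment is by design.
set_option linter.dupNamespace false

open scoped InnerProductSpace Topology
open MeasureTheory Filter UnitAddTorus
open Literature.Analysis.FunctionSpaces Literature.Analysis.FunctionSpaces.Torus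

namespace Summit.AnomalousDissipation.AnomalousDissipation.Theorems.WindLineWindyGalerkinSteadyZerothLaw

/-- The flat three-torus (local notation). -/
local notation "𝕋³" => UnitAddTorus (Fin 3)
/-- Velocity values (local notation). -/
local notation "E³" => EuclideanSpace ℝ (Fin 3)

/-! ## `L²` bookkeeping -/

-- adapted from Literature/Analysis/FluidPDE/Ferrari1993EnergyIdentity.lean
-- (`integral_norm_sq_eq_toReal_eLpNorm_two_sq`)
/-- `∫ ‖f‖² = ‖f‖_{L²}²` for `f ∈ L²(T³; ℝ³)`, the `L²` norm being that of `MemLp.toLp f`. -/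
theorem integral_norm_sq_eq_norm_toLp_sq {f : 𝕋³ → E³} (hf : MemLp f 2 volume) :
    ∫ x, ‖f x‖ ^ 2 = ‖hf.toLp f‖ ^ 2 := by
  rw [Lp.norm_toLp, hf.eLpNorm_eq_integral_rpow_norm two_ne_zero ENNReal.ofNat_ne_top]
  simp only [ENNReal.toReal_ofNat, Real.rpow_two]
  have h0 : 0 ≤ ∫ x, ‖f x‖ ^ 2 := integral_nonneg fun x => by positivity
  have e : (∫ x, ‖f x‖ ^ 2) ^ (2 : ℝ)⁻¹ = Real.sqrt (∫ x, ‖f x‖ ^ 2) := by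
    rw [Real.sqrt_eq_rpow, one_div]
  rw [e, ENNReal.toReal_ofReal (Real.sqrt_nonneg _), Real.sq_sqrt h0]

/-- **Energy continuity under `L²` convergence**: for smooth fields, `∫ ‖F N − f‖² → 0` implies
`∫ ‖F N‖² → ∫ ‖f‖²` (reverse triangle inequality in `L²(T³; ℝ³)`). -/
theorem tendsto_integral_norm_sq {f : 𝕋³ → E³} {F : ℕ → 𝕋³ → E³} (hf : IsSmooth f)
    (hF : ∀ N, IsSmooth (F N))
    (h : Tendsto (fun N => ∫ x, ‖F N x - f x‖ ^ 2) atTop (𝓝 0)) :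
    Tendsto (fun N => ∫ x, ‖F N x‖ ^ 2) atTop (𝓝 (∫ x, ‖f x‖ ^ 2)) := by
  set t : Lp E³ 2 (volume : Measure 𝕋³) := (hf.memLp 2).toLp f with ht
  set T : ℕ → Lp E³ 2 (volume : Measure 𝕋³) := fun N => ((hF N).memLp 2).toLp (F N) with hT
  have hdist : ∀ N, ‖T N - t‖ ^ 2 = ∫ x, ‖F N x - f x‖ ^ 2 := by
    intro N
    have hsub : MemLp (fun x => F N x - f x) 2 volume := ((hF N).memLp 2).sub (hf.memLp 2)
    have e : T N - t = hsub.toLp _ := (MemLp.toLp_sub ((hF N).memLp 2) (hf.memLp 2)).symm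
    rw [e, ← integral_norm_sq_eq_norm_toLp_sq]
  have h1 : Tendsto (fun N => ‖T N - t‖) atTop (𝓝 0) := by
    have h2 : Tendsto (fun N => Real.sqrt (‖T N - t‖ ^ 2)) atTop (𝓝 (Real.sqrt 0)) :=
      (h.congr fun N => (hdist N).symm).sqrt
    simpa [Real.sqrt_sq (norm_nonneg _)] using h2
  have h3 : Tendsto T atTop (𝓝 t) := tendsto_iff_norm_sub_tendsto_zero.2 h1
  have h4 : Tendsto (fun N => ‖T N‖ ^ 2) atTop (𝓝 (‖t‖ ^ 2)) := h3.norm.pow 2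
  rw [integral_norm_sq_eq_norm_toLp_sq (hf.memLp 2)]
  exact h4.congr fun N => (integral_norm_sq_eq_norm_toLp_sq ((hF N).memLp 2)).symm

/-! ## The gradient part, coordinatewise -/

-- adapted from Literature/Analysis/FluidPDE/Antidivergence.lean (`partialDeriv_sub_at`)
/-- `∂ᵢ (f − g)(x) = ∂ᵢ f(x) − ∂ᵢ g(x)` for smooth fields (lambda form). -/
theorem partialDeriv_sub_apply {f g : 𝕋³ → E³} (hf : IsSmooth f) (hg : IsSmooth g) (i : Fin 3)
    (x : 𝕋³) : partialDeriv i (fun y => f y - g y) x = partialDeriv i f x - partialDeriv i g x := by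
  have h1 : (fun y => f y - g y) = f + (-1 : ℝ) • g := by
    funext y; simp [sub_eq_add_neg]
  rw [h1, partialDeriv_add (hf.isContDiff (by simp)) ((hg.isContDiff (by simp)).smul (-1)),
    Pi.add_apply, partialDeriv_const_smul (hg.isContDiff (by simp)), Pi.smul_apply]
  simp [sub_eq_add_neg]

/-- `gradNormSq v = ∑ᵢ ∫ ‖∂ᵢ v‖²` for smooth `v` (the summands are integrable). -/
theorem gradNormSq_eq_sum_integral {v : 𝕋³ → E³} (hv : IsSmooth v) :
    gradNormSq v = ∑ i, ∫ x, ‖partialDeriv i v x‖ ^ 2 := by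
  unfold gradNormSq
  rw [integral_finsetSum]
  intro i _
  exact ((hv.partialDeriv i).norm_sq).integrable

/-- A single coordinate of the squared gradient norm is dominated by the whole:
`∫ ‖∂ᵢ v‖² ≤ gradNormSq v` for smooth `v`. -/
theorem integral_norm_partialDeriv_sq_le {v : 𝕋³ → E³} (hv : IsSmooth v) (i : Fin 3) :
    ∫ x, ‖partialDeriv i v x‖ ^ 2 ≤ gradNormSq v := by
  rw [gradNormSq_eq_sum_integral hv]
  exact Finset.single_le_sum (f := fun j => ∫ x, ‖partialDeriv j v x‖ ^ 2)
    (fun j _ => integral_nonneg fun x => by positivity) (Finset.mem_univ i)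

/-! ## Main theorem -/

/-- **Registered stub `stub_normsOfH1Limit`.**  If `∫ ‖U N − u‖² + ‖∇(U N − u)‖₂² → 0` for smooth
fields on `T³`, then `∫ ‖U N‖² → ∫ ‖u‖²` and `‖∇ U N‖₂² → ‖∇ u‖₂²`. -/
theorem stub_normsOfH1Limit :
    ∀ (u : 𝕋³ → E³) (U : ℕ → 𝕋³ → E³), IsSmooth u → (∀ N, IsSmooth (U N)) →
      Tendsto (fun N => (∫ x, ‖U N x - u x‖ ^ 2) + gradNormSq (fun x => U N x - u x)) atTop (𝓝 0) →
      Tendsto (fun N => ∫ x, ‖U N x‖ ^ 2) atTop (𝓝 (∫ x, ‖u x‖ ^ 2)) ∧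
        Tendsto (fun N => gradNormSq (U N)) atTop (𝓝 (gradNormSq u)) := by
  intro u U hu hU h
  -- both summands are nonnegative, hence each tends to zero
  have hA0 : ∀ N, 0 ≤ ∫ x, ‖U N x - u x‖ ^ 2 := fun N => integral_nonneg fun x => by positivity
  have hB0 : ∀ N, 0 ≤ gradNormSq (fun x => U N x - u x) := fun N => gradNormSq_nonneg _
  have hA : Tendsto (fun N => ∫ x, ‖U N x - u x‖ ^ 2) atTop (𝓝 0) :=
    tendsto_of_tendsto_of_tendsto_of_le_of_le tendsto_const_nhds h hA0
      fun N => le_add_of_nonneg_right (hB0 N)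
  have hB : Tendsto (fun N => gradNormSq (fun x => U N x - u x)) atTop (𝓝 0) :=
    tendsto_of_tendsto_of_tendsto_of_le_of_le tendsto_const_nhds h hB0
      fun N => le_add_of_nonneg_left (hA0 N)
  refine ⟨tendsto_integral_norm_sq hu hU hA, ?_⟩
  -- gradient part: coordinatewise `L²` convergence of `∂ᵢ U N → ∂ᵢ u`
  have hsm : ∀ N, IsSmooth (fun x => U N x - u x) := fun N => (hU N).sub hu
  have hi : ∀ i : Fin 3, Tendsto (fun N => ∫ x, ‖partialDeriv i (U N) x‖ ^ 2) atTop
      (𝓝 (∫ x, ‖partialDeriv i u x‖ ^ 2)) := by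
    intro i
    refine tendsto_integral_norm_sq (hu.partialDeriv i) (fun N => (hU N).partialDeriv i) ?_
    have hBi : Tendsto (fun N => ∫ x, ‖partialDeriv i (fun y => U N y - u y) x‖ ^ 2) atTop (𝓝 0) :=
      tendsto_of_tendsto_of_tendsto_of_le_of_le tendsto_const_nhds hB
        (fun N => integral_nonneg fun x => by positivity)
        fun N => integral_norm_partialDeriv_sq_le (hsm N) i
    refine hBi.congr fun N => ?_
    simp_rw [partialDeriv_sub_apply (hU N) hu]
  rw [gradNormSq_eq_sum_integral hu]
  have hsum := tendsto_finsetSum (Finset.univ : Finset (Fin 3)) fun i _ => hi i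
  exact hsum.congr fun N => (gradNormSq_eq_sum_integral (hU N)).symm

end Summit.AnomalousDissipation.AnomalousDissipation.Theorems.WindLineWindyGalerkinSteadyZerothLaw
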